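import Literature.Computability.Complexity.IWAmpHybrid
import Literature.Computability.MetaComplexity.NWPseudorandom
import Literature.Computability.MetaComplexity.NWLexicodeDesigns
import Literature.Computability.Complexity.MajorityCircuit
import Literature.Computability.Complexity.GF2Circuits
import Literature.Computability.Complexity.AdderBlocks
import HarnessLib

/-!
# The Impagliazzo–Wigderson code: from approximate list decoding to a small circuit, and the block family

Circuit form of the tree's derandomized XOR lemma `IWAmp.exists_majority_advPred`
(`IWAmpHybrid.lean`: Healy–Vadhan–Viola / Hirahara's proof of the approximate list-decodability of
`Amp^f = f^{⊕k} ∘ (ND ⊕ Hit)`, Hirahara 2022, Lemma 8.1), which concludes with the majority of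
`T ≤ C²` ADVICE PREDICTORS, each one query to the received word plus `k` table lookups. Here the
received word is a `B₂`-circuit on the seed BITS and the conclusion is a `B₂`-circuit for `f`:

* `encSeed` — seeds `(x, (t, b))` as `d + (N+m) + N` bits; `cktSize_advX`, `cktSize_query` (the
  `x`-part of the advice seed is wired from the challenge, the Hankel part hardwired), `cktSize_tables`
  (a table on the `≤ maxT` positions a block reads: `univBound maxT` gates,
  `MetaComplexity.cktSize_of_dependsOn`), `cktSize_advTest`, `cktSize_advPred`, `predSize`;
* `dupVotes`, `maj_dupVotes`, `cktSize_dupVotes` — a positive vote margin wins the majority of the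
  duplicated votes plus a dummy (`2T+1` voters, `MajorityCircuit.cktSize_maj`);
* **`exists_circuit_of_agree`** — if a `B₂`-circuit of size `S` agrees with `Amp^f` on a
  `(1/2 + ε)` fraction of the seeds (`k ε δ ≥ 6`, `C ε δ ≥ 2k`, blocks reading `≤ maxT` positions of
  each other), then a `B₂`-circuit of size `≤ (2C² + 1) · predSize d k S maxT + 9C² + 3` computes `f`
  on all but fewer than `δ 2ᴺ` inputs;
* `iwBlocks`, `card_Tsub_iwBlocks_le` — the block family from the greedy design words of
  `NWLexicodeDesigns.lean` over a constant alphabet `b` (universe `[N] × [b]`, seed part `N b` bits,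
  i.e. linear length), whose blocks read at most `agr` positions of each other.

This is the decoding half of the mild-to-strong amplification inside `E` needed for
`impagliazzo_wigderson` (`CircuitLowerBoundsIW.impagliazzo_wigderson_of_mildToStrong`): with
`ε = 2^{-Ω(N)}`, `δ = N^{-6}` and `k, C = 2^{O(N)}` the size stays `2^{O(N)} · S`, affordable against
the `2^{Ω(N)}` mild hardness of `HardLangM.exists_mildHard_E`.

## References

* S. Hirahara, *NP-hardness of learning programs and partial MCSP*, ECCC TR22-119, Lemma 8.1
  [Hirahara2022PartialMCSP].
* R. Impagliazzo, A. Wigderson, *P = BPP if E requires exponential circuits*, STOC 1997, Thm. 1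
  [ImpagliazzoWigderson1997].
* S. Arora, B. Barak, *Computational Complexity: A Modern Approach*, CUP 2009, Lemma 20.14
  [AroraBarakCC2009].
-/

noncomputable section

namespace Literature.Computability.Complexity

open Finset MetaComplexity

namespace IWAmpBridge

variable {N d m k : ℕ}

/-! ### Seeds as bit vectors -/

/-- The bit positions of a Hankel seed `(t, b) ∈ 𝔽₂^{N+m} × 𝔽₂ᴺ`. [folklore] -/
abbrev HBits (N m : ℕ) : Type := Fin (N + m) ⊕ Fin N

/-- A Hankel seed as bits. [folklore] -/
def encHankel (y : Hankel.Seed N m) : HBits N m → Bool :=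
  Sum.elim (fun c => decide (y.1 c ≠ 0)) (fun r => decide (y.2 r ≠ 0))

/-- A seed `σ = (x, y)` as bits: the `d` bits of `x`, then the Hankel seed. [folklore] -/
def encSeed (σ : IWAmp.Seed N d m) : Fin d ⊕ HBits N m → Bool := Sum.elim σ.1 (encHankel σ.2)

variable (e : Fin k → (Fin N ↪ Fin d)) (idx : Fin k → Fin m → ZMod 2)

/-! ### The advice predictor as a circuit -/

/-- **The `x`-part of the advice seed is wired from the challenge**: each of the `d` positions is the
constant `xo p` or `v r ⊕ hit r` for the block position `r` it carries. [folklore] -/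
theorem cktSize_advX (i : Fin k) (xo : Fin d → Bool) (y : Hankel.Seed N m) :
    CktSize B2 (fun (v : Fin N → Bool) (p : Fin d) => (IWAmp.advSeed (e := e) (idx := idx) i xo y v).1 p) (Fintype.card (Fin d) * 1) := by
  classical
  refine CktSize.pi_const fun p => ?_
  by_cases h : ∃ r, e i r = p
  · obtain ⟨r, hr⟩ := h
    refine (cktSize_xorConst (ι := Fin N) r (IWAmp.hitB idx y i r)).congr fun v _ => ?_
    show _ = Function.extend (e i) (fun r => xor (v r) (IWAmp.hitB idx y i r)) xo p
    rw [← hr, (e i).injective.extend_apply]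
  · refine (cktSize_const (Fin N) (xo p)).congr fun v _ => ?_
    show _ = Function.extend (e i) (fun r => xor (v r) (IWAmp.hitB idx y i r)) xo p
    rw [Function.extend_apply' _ _ _ h]

/-- **One query to the received word** on the advice seed: the circuit for `G` (on seed bits,
size `S`) with the Hankel bits hardwired, fed by the wiring of the `x`-part. [folklore] -/
theorem cktSize_query (Gb : (Fin d ⊕ HBits N m → Bool) → Bool) {S : ℕ} (hG : CktSize B2 (fun s (_ : Unit) => Gb s) S)
    (i : Fin k) (xo : Fin d → Bool) (y : Hankel.Seed N m) :
    CktSize B2 (fun (v : Fin N → Bool) (_ : Unit) => Gb (encSeed (IWAmp.advSeed (e := e) (idx := idx) i xo y v)))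
      (Fintype.card (Fin d) * 1 + (S + 2)) := by
  refine ((cktSize_advX e idx i xo y).comp (hG.hardwire (encHankel y))).congr fun v _ => ?_
  simp only [encSeed]
  rfl

/-- **The advice tables**: the bit of block `j ≠ i` is a table lookup on the `≤ maxT` positions of
block `i` that block `j` reads (`univBound maxT` gates each), position `i` gets the constant `b`. [folklore] -/
theorem cktSize_tables (i : Fin k) (tbl : (j : Fin k) → (IWAmp.Tsub e i j → Bool) → Bool) {maxT : ℕ}
    (hT : ∀ j, Fintype.card (IWAmp.Tsub e i j) ≤ maxT) (b : Bool) :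
    CktSize B2 (fun (v : Fin N → Bool) (j : Fin k) => if j = i then b else tbl j fun r' => v r'.1)
      (Fintype.card (Fin k) * univBound maxT) := by
  classical
  refine CktSize.pi_const fun j => ?_
  by_cases hj : j = i
  · simp only [hj, if_true]
    exact (cktSize_const (Fin N) b).of_le (univBound_pos maxT)
  · simp only [hj, if_false]
    refine cktSize_of_dependsOn (F := fun v => tbl j fun r' => v r'.1)
      (Finset.univ.image fun r' : IWAmp.Tsub e i j => r'.1) (card_image_le.trans (by rw [card_univ]; exact hT j)) fun x x' h => ?_
    congr 1
    funext r'
    exact h r'.1 (mem_image_of_mem _ (mem_univ r'))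

/-- **The one-query test of the advice** `advTest D_G a v b = [G(σ') = ⊕ bits]` as a circuit. [folklore] -/
theorem cktSize_advTest (Gb : (Fin d ⊕ HBits N m → Bool) → Bool) {S : ℕ} (hG : CktSize B2 (fun s (_ : Unit) => Gb s) S)
    (a : IWAmp.Adv e (m := m)) {maxT : ℕ} (hT : ∀ i j, Fintype.card (IWAmp.Tsub e i j) ≤ maxT) (b : Bool) :
    CktSize B2 (fun (v : Fin N → Bool) (_ : Unit) =>
        IWAmp.advTest (e := e) (idx := idx) (IWAmp.agreeTest fun σ => Gb (encSeed σ)) a v b)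
      ((Fintype.card (Fin d) * 1 + (S + 2)) + (Fintype.card (Fin k) * univBound maxT + (k + 1)) + 1) := by
  obtain ⟨i, xo, y, c, tbl⟩ := a
  have hq := cktSize_query e idx Gb hG i xo y
  have hp := (cktSize_tables e i tbl (hT i) b).comp (cktSize_parityFin k)
  have h := (hq.pair hp).comp (cktSize_bin (ι := Unit ⊕ Unit) (fun g p => g == p) (.inl ()) (.inr ()))
  refine h.congr fun v _ => ?_
  rfl

/-- The size of one advice predictor. [folklore] -/
def predSize (d k S maxT : ℕ) : ℕ := 2 * ((d * 1 + (S + 2)) + (k * univBound maxT + (k + 1)) + 1) + 1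

/-- **The advice predictor as a circuit** (`pred A c v = if A v 1 = A v 0 then c else A v 1`, two copies
of the test and one gate). [cite: Hirahara2022PartialMCSP, proof of Lemma 8.1 ("a g-oracle program of size 2^{γn}·poly(1/ϵδ)")] -/
theorem cktSize_advPred (Gb : (Fin d ⊕ HBits N m → Bool) → Bool) {S : ℕ} (hG : CktSize B2 (fun s (_ : Unit) => Gb s) S)
    (a : IWAmp.Adv e (m := m)) {maxT : ℕ} (hT : ∀ i j, Fintype.card (IWAmp.Tsub e i j) ≤ maxT) :
    CktSize B2 (fun (v : Fin N → Bool) (_ : Unit) =>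
        IWAmp.advPred (e := e) (idx := idx) (IWAmp.agreeTest fun σ => Gb (encSeed σ)) a v) (predSize d k S maxT) := by
  have h1 := cktSize_advTest e idx Gb hG a hT true
  have h0 := cktSize_advTest e idx Gb hG a hT false
  have h := (h1.pair h0).comp (cktSize_bin (ι := Unit ⊕ Unit) (fun b1 b0 => if b1 = b0 then a.2.2.2.1 else b1) (.inl ()) (.inr ()))
  refine (h.of_le (le_of_eq ?_)).congr fun v _ => rfl
  simp only [predSize, Fintype.card_fin]
  ring

/-! ### The majority vote of the advice predictors -/

/-- Duplicated votes plus one dummy: `2T + 1` voters `P₀, P₀, P₁, P₁, …, P_{T-1}, P_{T-1}, 0`. [folklore] -/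
def dupVotes {U : Type*} (P : ℕ → U → Bool) (T : ℕ) (v : U) : Fin (2 * T + 1) → Bool :=
  fun l => if (l : ℕ) < 2 * T then P (l / 2) v else false

/-- **A positive margin wins the duplicated majority.** [folklore] -/
theorem maj_dupVotes {U : Type*} (f : U → Bool) (P : ℕ → U → Bool) (T : ℕ) (v : U)
    (h : 0 < HardCore.margin f P T v) : (GateFn.maj (2 * T + 1)).2 (dupVotes P T v) = f v := by
  classical
  -- count the agreeing voters: twice the agreeing predictors
  set A := (Finset.range T).filter fun j => P j v = f v with hA
  have hmargin : HardCore.margin f P T v = 2 * (A.card : ℤ) - T := by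
    unfold HardCore.margin HardCore.sgn
    rw [Finset.sum_ite, Finset.sum_const, Finset.sum_const, nsmul_eq_mul, nsmul_eq_mul, mul_one, mul_neg, mul_one, ← hA]
    have := Finset.card_filter_add_card_filter_not (s := Finset.range T) (fun j => P j v = f v)
    rw [Finset.card_range, ← hA] at this
    have h2 : (((Finset.range T).filter fun j => ¬ P j v = f v).card : ℤ) = T - A.card := by
      have : ((Finset.range T).filter fun j => ¬ P j v = f v).card = T - A.card := by omega
      rw [this, Nat.cast_sub (by omega)]
    rw [h2]
    ring
  have hAT : A.card ≤ T := (card_filter_le _ _).trans (by rw [card_range])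
  have hAgt : T < 2 * A.card := by
    have : (T : ℤ) < 2 * (A.card : ℤ) := by linarith
    exact_mod_cast this
  -- the agreeing duplicated voters
  have hcount : 2 * A.card ≤ (Finset.univ.filter fun l : Fin (2 * T + 1) => dupVotes P T v l = f v).card := by
    -- the injection `(j, c) ↦ 2j + c`
    let ι' : A ×ˢ (Finset.univ : Finset (Fin 2)) → Fin (2 * T + 1) := fun p =>
      ⟨2 * p.1.1 + p.1.2, by
        have := mem_range.1 (mem_filter.1 (Finset.mem_product.1 p.2).1).1
        have h2 := p.1.2.isLt; omega⟩
    have hinj : Function.Injective ι' := by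
      rintro ⟨⟨j, c⟩, hp⟩ ⟨⟨j', c'⟩, hp'⟩ hh
      simp only [ι', Fin.mk.injEq] at hh
      have hc := c.isLt; have hc' := c'.isLt
      have : j = j' := by omega
      subst this
      have : (c : ℕ) = c' := by omega
      exact Subtype.ext (Prod.ext rfl (Fin.ext this))
    have himg : (Finset.univ.image ι') ⊆ Finset.univ.filter fun l : Fin (2 * T + 1) => dupVotes P T v l = f v := by
      intro l hl
      obtain ⟨⟨⟨j, c⟩, hp⟩, -, rfl⟩ := mem_image.1 hl
      have hj := (mem_filter.1 (Finset.mem_product.1 hp).1)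
      have hjT := mem_range.1 hj.1
      rw [mem_filter]
      refine ⟨mem_univ _, ?_⟩
      simp only [ι', dupVotes]
      have hc := c.isLt
      rw [if_pos (by omega), show (2 * j + (c : ℕ)) / 2 = j by omega]
      exact hj.2
    calc 2 * A.card = (A ×ˢ (Finset.univ : Finset (Fin 2))).card := by rw [card_product, card_univ, Fintype.card_fin, mul_comm]
      _ = (Finset.univ.image ι').card := by rw [card_image_of_injective _ hinj, card_univ, Fintype.card_coe]
      _ ≤ _ := card_le_card himg
  -- conclude with the majority gate semantics
  change decide (2 * T + 1 ≤ 2 * GateFn.numOnes (dupVotes P T v)) = f v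
  unfold GateFn.numOnes
  have htot := Finset.card_filter_add_card_filter_not (s := (Finset.univ : Finset (Fin (2 * T + 1)))) (fun l => dupVotes P T v l = true)
  rw [card_univ, Fintype.card_fin] at htot
  cases hfv : f v with
  | true =>
    rw [hfv] at hcount
    exact decide_eq_true (by omega)
  | false =>
    rw [hfv] at hcount
    have : (Finset.univ.filter fun l : Fin (2 * T + 1) => ¬ dupVotes P T v l = true) =
        Finset.univ.filter fun l : Fin (2 * T + 1) => dupVotes P T v l = false := by
      congr 1; ext l; simp
    rw [this] at htot
    exact decide_eq_false (by omega)

/-- **The duplicated votes as a circuit**: `2T + 1` predictor circuits of size `≤ sz` (the dummy is a constant). [folklore] -/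
theorem cktSize_dupVotes {P : ℕ → (Fin N → Bool) → Bool} {sz : ℕ} (hsz : 1 ≤ sz) (hP : ∀ j, CktSize B2 (fun v (_ : Unit) => P j v) sz) (T : ℕ) :
    CktSize B2 (fun (v : Fin N → Bool) (l : Fin (2 * T + 1)) => dupVotes P T v l) (Fintype.card (Fin (2 * T + 1)) * sz) := by
  refine CktSize.pi_const fun l => ?_
  by_cases h : (l : ℕ) < 2 * T
  · refine (hP (l / 2)).congr fun v _ => ?_
    simp [dupVotes, h]
  · refine ((cktSize_const (Fin N) false).of_le hsz).congr fun v _ => ?_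
    simp [dupVotes, h]

/-- One advice predictor costs at least one gate. [folklore] -/
theorem one_le_predSize (d k S maxT : ℕ) : 1 ≤ predSize d k S maxT := by unfold predSize; omega

/-- **From approximate list decoding to a small circuit** (the Impagliazzo–Wigderson / Healy–Vadhan–
Viola derandomized XOR lemma in circuit form, on top of the tree's `IWAmp.exists_majority_advPred`,
Hirahara 2022, Lemma 8.1): if a `B₂`-circuit of size `S` on the seed bits agrees with `Amp^f` on a
`(1/2 + ε)` fraction of the seeds (`k ε δ ≥ 6`, `C ε δ ≥ 2k`, hitter indexing injective, every block
reads at most `maxT` positions of every other block), then a `B₂`-circuit of size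
`≤ (2C² + 1) · predSize d k S maxT + 9C² + 3` computes `f` on all but fewer than `δ 2ᴺ` inputs: the
majority (duplicated, `MajorityCircuit.cktSize_maj`) of the `T ≤ C²` advice predictors, each one
query to the received word plus `k` table lookups of `≤ maxT` bits (`predSize`).
[cite: Hirahara2022PartialMCSP, Lemma 8.1 ("a g-oracle program of size 2^{γn}·poly(1/ϵδ) that agrees with f on a (1−δ)-fraction of inputs")] -/
theorem exists_circuit_of_agree (hidx : Function.Injective idx) (f : (Fin N → Bool) → Bool) {ε δ : ℝ} (hε : 0 < ε)
    (hδ : 0 < δ) (hkεδ : 6 ≤ k * ε * δ) {C : ℕ} (hCεδ : 2 * k ≤ C * ε * δ) {maxT : ℕ}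
    (hT : ∀ i j, Fintype.card (IWAmp.Tsub e i j) ≤ maxT)
    (Gb : (Fin d ⊕ HBits N m → Bool) → Bool) {S : ℕ} (hG : CktSize B2 (fun s (_ : Unit) => Gb s) S)
    (hagree : (1 / 2 + ε) * Fintype.card (IWAmp.Seed N d m) ≤
      ((Finset.univ.filter fun σ : IWAmp.Seed N d m => Gb (encSeed σ) = IWAmp.amp e idx f σ).card : ℝ)) :
    ∃ K : Circuit (Fin N), K.IsOver B2 ∧ K.size ≤ (2 * C ^ 2 + 1) * predSize d k S maxT + (9 * C ^ 2 + 3) ∧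
      ((Finset.univ.filter fun v => K.eval v ≠ f v).card : ℝ) < δ * 2 ^ N := by
  classical
  obtain ⟨T, advs, hTC, herr⟩ := IWAmp.exists_majority_advPred (e := e) (idx := idx) (f := f) hidx hε hδ hkεδ hCεδ
    (fun σ => Gb (encSeed σ)) hagree
  set P : ℕ → (Fin N → Bool) → Bool := fun j => IWAmp.advPred (e := e) (idx := idx) (IWAmp.agreeTest fun σ => Gb (encSeed σ)) (advs j)
    with hP
  have hPsz : ∀ j, CktSize B2 (fun v (_ : Unit) => P j v) (predSize d k S maxT) := fun j =>
    cktSize_advPred e idx Gb hG (advs j) hT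
  -- the duplicated majority circuit
  have hV := cktSize_dupVotes (N := N) (one_le_predSize d k S maxT) hPsz T
  have hM := hV.comp (cktSize_maj T)
  rw [Fintype.card_fin] at hM
  obtain ⟨K, hKB, hKs, hKe⟩ := hM.toCircuit
  refine ⟨K, hKB, hKs.trans ?_, ?_⟩
  · have : (2 * T + 1) * predSize d k S maxT ≤ (2 * C ^ 2 + 1) * predSize d k S maxT :=
      Nat.mul_le_mul_right _ (by nlinarith)
    have : 9 * T + 3 ≤ 9 * C ^ 2 + 3 := by nlinarith
    omega
  · -- the circuit errs only where the margin is `≤ 0`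
    refine lt_of_le_of_lt ?_ (by rw [Fintype.card_fun, Fintype.card_bool, Fintype.card_fin] at herr; exact_mod_cast herr)
    exact_mod_cast card_le_card fun v hv => by
      rw [mem_filter] at hv ⊢
      refine ⟨mem_univ _, ?_⟩
      by_contra hpos
      push Not at hpos
      exact hv.2 (by rw [hKe]; exact maj_dupVotes f P T v hpos)

/-! ### The block family: greedy design words over a constant alphabet -/

/-- **The IW block family** from the greedy design words of `NWLexicodeDesigns.lean`: block `i` is the
graph of the `i`-th word `wᵢ : [N] → [b]`, placed in the universe `[N] × [b] ≃ [N b]` (seed part of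
`N b` bits: linear in `N` for a constant alphabet `b`). [cite: AroraBarakCC2009, Lemma 20.14] -/
def iwBlocks (N b agr K : ℕ) (h : K ≤ (lexWords N b agr).length) : Fin K → (Fin N ↪ Fin (N * b)) :=
  fun i => (lexDesign N b agr K h i).trans finProdFinEquiv.toEmbedding

/-- **Blocks read few positions of each other**: block `j ≠ i` reads at most `agr` positions of block
`i` (the agreements of the two words), and block `i` reads none of itself by definition. [folklore] -/
theorem card_Tsub_iwBlocks_le {N b agr K : ℕ} (h : K ≤ (lexWords N b agr).length) (i j : Fin K) :
    Fintype.card (IWAmp.Tsub (iwBlocks N b agr K h) i j) ≤ agr := by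
  classical
  by_cases hji : j = i
  · -- no position: `Tsub e i i` is empty
    have : IsEmpty (IWAmp.Tsub (iwBlocks N b agr K h) i j) := ⟨fun r' => r'.2.1 hji⟩
    rw [Fintype.card_eq_zero]; exact Nat.zero_le _
  · -- positions read are agreements of the words
    have hagr := agree_lexDesignWords_le h (Ne.symm hji)
    unfold agree at hagr
    refine le_trans ?_ hagr
    rw [← Fintype.card_coe]
    refine Fintype.card_le_of_injective (fun r' => ⟨r'.1, ?_⟩) (fun r₁ r₂ hh => Subtype.ext (by simpa using congrArg Subtype.val hh))
    obtain ⟨-, r, hr⟩ := r'.2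
    rw [mem_filter]
    refine ⟨mem_univ _, ?_⟩
    -- `e j r = e i r'` unfolds to `(r, w_j r) = (r', w_i r')`
    simp only [iwBlocks, Function.Embedding.trans_apply, Equiv.toEmbedding_apply, EmbeddingLike.apply_eq_iff_eq, lexDesign,
      graphBlock, Function.Embedding.coeFn_mk, Prod.mk.injEq] at hr
    obtain ⟨rfl, hw⟩ := hr
    exact hw.symm

end IWAmpBridge

end Literature.Computability.Complexity

end
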